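import Summits.CriticalPhenomena.CardyFormulaZ2.Theorems.CardyComplexConeSLESixFamiliesGiveCardySmoothMarkFamiliesPart2
import Literature.Probability.RandomPlanarGeometry.MarkedDomainCorners
import HarnessLib

/-!
# drefute gen-7 — registered helper `smoothMark_part5` (STUB F, part 5/10): candidate proof

`smoothMark_part5` (registered 2026-08-16T05:16Z): in the monotone `1`-Lipschitz frame chart of radius
`R ≤ dist (pt (i+1)) (pt i)` at the mark `pt i`, the right half-graph `{P c : α < c}` lies in one arc
`D.arc σ` and off the other, and the left half-graph in `D.arc (σ + 1)` and off `D.arc σ`.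
Proof: graph points in the chart are frontier points and (for `c ≠ α`) not marks, hence in exactly one
arc (`mem_arc_inter_arc`); each half-parameter set is order-connected (the distance to `pt i` is
monotone along each half, by monotonicity of `G`), so its image is preconnected and lies in ONE closed
arc (`isPreconnected_iff_subset_of_disjoint_closed`); the two halves use DIFFERENT arcs because the other
arc `D.arc (σ + 1)`, being connected from `pt i` to `pt (i + 1)` (at distance `≥ R`), has a point in the
punctured chart ball, which is a graph point `P c`, `c ≠ α`, hence would lie on both arcs — a mark.
-/

noncomputable section

open Set Metric Filter Topology
open Literature.Probability Literature.Probability.RandomPlanarGeometry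
  Literature.Probability.LatticeModels

namespace Summit.CriticalPhenomena.CardyFormulaZ2.Cruxes.SLESixFamiliesGiveCardy.CollarTouchSandwich
namespace DrefuteG7

section Chart5

variable {k : Fin 2} {s t : ℤ} {U V : ℂ} (hs : s = 1 ∨ s = -1) (ht : t = 1 ∨ t = -1)
  (hU : U = Site.toComplex (Pi.single k s)) (hV : V = Site.toComplex (Pi.single k.rev t))
  {Ω : Set ℂ} {G : ℝ → ℝ} {p : ℂ} {R : ℝ} (hΩ : IsOpen Ω)
  (hLip : ∀ a b, |G a - G b| ≤ |a - b|)
  (hchart : ∀ a b : ℝ, dist ((a : ℂ) * U + (b : ℂ) * V) p < R → ((a : ℂ) * U + (b : ℂ) * V ∈ Ω ↔ G a < b))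

include hs ht hU hV in
/-- Frame coordinates of an arbitrary point. -/
theorem exists_frame_coord5 (z : ℂ) : ∃ c d : ℝ, z = (c : ℂ) * U + (d : ℂ) * V := by
  refine ⟨(z * (starRingEnd ℂ) U).re, (z * (starRingEnd ℂ) V).re, ?_⟩
  rw [hU, hV]
  exact frame_decomp k hs ht z

include hs ht hU hV hΩ hchart in
/-- Graph points inside the chart ball are frontier points. -/
theorem graph_mem_frontier5 {c : ℝ} (hc : dist ((c : ℂ) * U + ((G c : ℝ) : ℂ) * V) p < R) :
    (c : ℂ) * U + ((G c : ℝ) : ℂ) * V ∈ frontier Ω := by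
  rw [hΩ.frontier_eq]
  refine ⟨Metric.mem_closure_iff.2 fun ε hε => ?_, fun h => lt_irrefl _ ((hchart _ _ hc).1 h)⟩
  set η : ℝ := min (ε / 2) ((R - dist ((c : ℂ) * U + ((G c : ℝ) : ℂ) * V) p) / 2) with hη
  have hηpos : 0 < η := lt_min (by linarith) (by linarith)
  have hηε : η ≤ ε / 2 := min_le_left _ _
  have hηR : η ≤ (R - dist ((c : ℂ) * U + ((G c : ℝ) : ℂ) * V) p) / 2 := min_le_right _ _
  have hd : dist ((c : ℂ) * U + ((G c + η : ℝ) : ℂ) * V) ((c : ℂ) * U + ((G c : ℝ) : ℂ) * V) ≤ η := by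
    refine (SmoothMark.dist_le_abs_add_abs_frame hs ht hU hV _ _ _ _).trans ?_
    simp [abs_of_pos hηpos]
  refine ⟨(c : ℂ) * U + ((G c + η : ℝ) : ℂ) * V, (hchart _ _ ?_).2 (by linarith), ?_⟩
  · have := dist_triangle ((c : ℂ) * U + ((G c + η : ℝ) : ℂ) * V)
      ((c : ℂ) * U + ((G c : ℝ) : ℂ) * V) p
    linarith
  · rw [dist_comm]; linarith

include hs ht hU hV hΩ hLip hchart in
/-- A frontier point inside the chart ball lies on the graph. -/
theorem frontier_coord5 {c d : ℝ} (hq : (c : ℂ) * U + (d : ℂ) * V ∈ frontier Ω)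
    (hqp : dist ((c : ℂ) * U + (d : ℂ) * V) p < R) : d = G c := by
  rw [hΩ.frontier_eq] at hq
  rcases lt_trichotomy (G c) d with h | h | h
  · exact absurd ((hchart c d hqp).2 h) hq.2
  · exact h.symm
  · exfalso
    set ε : ℝ := min ((G c - d) / 2) (R - dist ((c : ℂ) * U + (d : ℂ) * V) p) with hε
    have hεpos : 0 < ε := lt_min (by linarith) (by linarith)
    obtain ⟨z, hz, hzq⟩ := Metric.mem_closure_iff.1 hq.1 ε hεpos
    obtain ⟨c', d', rfl⟩ := exists_frame_coord5 hs ht hU hV z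
    have hcd := SmoothMark.abs_sub_le_dist_frame hs ht hU hV c d c' d'
    have hzp : dist ((c' : ℂ) * U + (d' : ℂ) * V) p < R := by
      have := dist_triangle ((c' : ℂ) * U + (d' : ℂ) * V) ((c : ℂ) * U + (d : ℂ) * V) p
      have hε2 : ε ≤ R - dist ((c : ℂ) * U + (d : ℂ) * V) p := min_le_right _ _
      rw [dist_comm] at hzq
      linarith
    have hin : G c' < d' := (hchart c' d' hzp).1 hz
    have hε1 : ε ≤ (G c - d) / 2 := min_le_left _ _
    have h1 : |c - c'| < ε := hcd.1.trans_lt hzq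
    have h2 : |d - d'| < ε := hcd.2.trans_lt hzq
    have hG : G c - G c' < ε := ((le_abs_self _).trans (hLip c c')).trans_lt h1
    have h2' := (abs_lt.1 h2).1
    linarith

end Chart5

/-- Both marked points of a Dobrushin domain lie on both arcs. -/
theorem pt_mem_arc_two (D : DobrushinDomain) (m τ : Fin 2) : D.pt m ∈ D.arc τ := by
  fin_cases m <;> fin_cases τ
  · exact D.pt_mem_arc_self 0
  · simpa using D.pt_succ_mem_arc 1
  · simpa using D.pt_succ_mem_arc 0
  · exact D.pt_mem_arc_self 1

/-- A point on two different arcs of a Dobrushin domain is a marked point. -/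
theorem eq_pt_of_mem_arc_of_mem_arc (D : DobrushinDomain) {σ τ : Fin 2} (hστ : τ ≠ σ) {z : ℂ}
    (hσ : z ∈ D.arc σ) (hτ : z ∈ D.arc τ) : ∃ m : Fin 2, z = D.pt m := by
  rcases D.mem_arc_inter_arc hστ hσ hτ with h | h
  · exact ⟨σ, h⟩
  · exact ⟨σ + 1, h⟩

/-- For a Dobrushin domain, `D.arc 0 ∪ D.arc 1` is the whole frontier. -/
theorem frontier_eq_arc_union (D : DobrushinDomain) : frontier D.carrier = D.arc 0 ∪ D.arc 1 := by
  have h : (⋃ i, D.arc i) = frontier D.carrier := D.iUnion_arc_holds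
  rw [← h]
  ext z
  simp only [mem_union, mem_iUnion, Fin.exists_fin_two]

/-- **`smoothMark_part5` verbatim (registered signature).** -/
theorem smoothMark_part5_proof : ∀ (D : DobrushinDomain) (i : Fin 2) (k : Fin 2) (s t : ℤ) (U V : ℂ) (G : ℝ → ℝ) (α R : ℝ), (s = 1 ∨ s = -1) → (t = 1 ∨ t = -1) → U = Site.toComplex (Pi.single k s) → V = Site.toComplex (Pi.single k.rev t) → D.pt i = (α : ℂ) * U + ((G α : ℝ) : ℂ) * V → Monotone G → (∀ a b, |G a - G b| ≤ |a - b|) → (∀ a b : ℝ, dist ((a : ℂ) * U + (b : ℂ) * V) (D.pt i) < R → ((a : ℂ) * U + (b : ℂ) * V ∈ D.carrier ↔ G a < b)) → R ≤ dist (D.pt (i + 1)) (D.pt i) → 0 < R → ∃ σ : Fin 2, (∀ c, α < c → dist ((c : ℂ) * U + ((G c : ℝ) : ℂ) * V) (D.pt i) < R → (c : ℂ) * U + ((G c : ℝ) : ℂ) * V ∈ D.arc σ ∧ (c : ℂ) * U + ((G c : ℝ) : ℂ) * V ∉ D.arc (σ + 1)) ∧ (∀ c, c < α → dist ((c : ℂ)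 * U + ((G c : ℝ) : ℂ) * V) (D.pt i) < R → (c : ℂ) * U + ((G c : ℝ) : ℂ) * V ∈ D.arc (σ + 1) ∧ (c : ℂ) * U + ((G c : ℝ) : ℂ) * V ∉ D.arc σ) := by
  intro D i k s t U V G α R hs ht hU hV hpt hmono hLip hchart hRdist hR
  -- the graph map
  set P : ℝ → ℂ := fun c => (c : ℂ) * U + ((G c : ℝ) : ℂ) * V with hP
  have hGcont : Continuous G :=
    (LipschitzWith.of_dist_le_mul fun x y => by
      simpa [Real.dist_eq, one_mul] using hLip x y : LipschitzWith 1 G).continuous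
  have hPcont : Continuous P := by
    simp only [hP]
    fun_prop
  have hPα : P α = D.pt i := by simp only [hP]; exact hpt.symm
  have hfin : ∀ σ : Fin 2, σ + 1 ≠ σ := by decide
  have hfin2 : ∀ σ : Fin 2, σ + 1 + 1 = σ := by decide
  have hfin3 : ∀ σ τ : Fin 2, τ ≠ σ → τ = σ + 1 := by decide
  -- graph points in the chart: frontier points; for `c ≠ α` not marks; in exactly one arc
  have hfr : ∀ c, dist (P c) (D.pt i) < R → P c ∈ frontier D.carrier := fun c hc =>
    graph_mem_frontier5 hs ht hU hV D.isOpen hchart hc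
  have hnotmark : ∀ c, c ≠ α → dist (P c) (D.pt i) < R → ∀ m : Fin 2, P c ≠ D.pt m := by
    intro c hc hd m h
    have hm : m = i ∨ m = i + 1 := by fin_cases i <;> fin_cases m <;> simp
    rcases hm with rfl | rfl
    · -- `P c = P α` forces `c = α`
      have h1 := (SmoothMark.abs_sub_le_dist_frame hs ht hU hV c (G c) α (G α)).1
      have h0 : dist (P c) (P α) = 0 := by rw [hPα, h, dist_self]
      simp only [hP] at h0
      rw [h0] at h1
      exact hc (by linarith [abs_nonneg (c - α), abs_eq_zero.1 (le_antisymm h1 (abs_nonneg _))])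
    · rw [h] at hd
      linarith
  have honly : ∀ c, c ≠ α → dist (P c) (D.pt i) < R → ∀ σ : Fin 2, P c ∈ D.arc σ → P c ∉ D.arc (σ + 1) := by
    intro c hc hd σ hσ hσ1
    obtain ⟨m, hm⟩ := eq_pt_of_mem_arc_of_mem_arc D (hfin σ) hσ hσ1
    exact hnotmark c hc hd m hm
  -- one arc per order-connected parameter set
  have hside : ∀ S : Set ℝ, S.OrdConnected → (∀ c ∈ S, c ≠ α ∧ dist (P c) (D.pt i) < R) →
      ∃ σ : Fin 2, ∀ c ∈ S, P c ∈ D.arc σ := by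
    intro S hS hSα
    have hpre : IsPreconnected (P '' S) := hS.isPreconnected.image P hPcont.continuousOn
    have hsub : P '' S ⊆ D.arc 0 ∪ D.arc 1 := by
      rintro _ ⟨c, hc, rfl⟩
      rw [← frontier_eq_arc_union]
      exact hfr c (hSα c hc).2
    have hdisj : P '' S ∩ (D.arc 0 ∩ D.arc 1) = ∅ := by
      ext z
      simp only [mem_inter_iff, mem_image, mem_empty_iff_false, iff_false, not_and]
      rintro ⟨c, hc, rfl⟩ h0 h1
      exact honly c (hSα c hc).1 (hSα c hc).2 0 h0 (by simpa using h1)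
    rcases (isPreconnected_iff_subset_of_disjoint_closed.1 hpre) (D.arc 0) (D.arc 1) (D.isClosed_arc 0)
        (D.isClosed_arc 1) hsub hdisj with h | h
    · exact ⟨0, fun c hc => h (mem_image_of_mem P hc)⟩
    · exact ⟨1, fun c hc => h (mem_image_of_mem P hc)⟩
  -- the two half-parameter sets are order-connected
  have hdist2 : ∀ c, dist (P c) (D.pt i) ^ 2 = (c - α) ^ 2 + (G c - G α) ^ 2 := by
    intro c
    rw [← hPα]
    exact SmoothMark.dist_sq_frame hs ht hU hV c (G c) α (G α)
  have hlt_of_sq : ∀ c c', dist (P c) (D.pt i) ^ 2 ≤ dist (P c') (D.pt i) ^ 2 →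
      dist (P c') (D.pt i) < R → dist (P c) (D.pt i) < R := by
    intro c c' h h'
    have h2 : dist (P c') (D.pt i) ^ 2 < R ^ 2 := pow_lt_pow_left₀ h' dist_nonneg (by norm_num)
    exact lt_of_pow_lt_pow_left₀ 2 hR.le (h.trans_lt h2)
  set Sp : Set ℝ := {c | α < c ∧ dist (P c) (D.pt i) < R} with hSp
  set Sm : Set ℝ := {c | c < α ∧ dist (P c) (D.pt i) < R} with hSm
  have hSp_oc : Sp.OrdConnected := by
    refine ⟨fun c₁ hc₁ c₂ hc₂ c hc => ⟨hc₁.1.trans_le hc.1, hlt_of_sq c c₂ ?_ hc₂.2⟩⟩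
    rw [hdist2, hdist2]
    have h1 : G α ≤ G c := hmono (hc₁.1.trans_le hc.1).le
    have h2 : G c ≤ G c₂ := hmono hc.2
    nlinarith [hc.1, hc.2, hc₁.1]
  have hSm_oc : Sm.OrdConnected := by
    refine ⟨fun c₁ hc₁ c₂ hc₂ c hc => ⟨hc.2.trans_lt hc₂.1, hlt_of_sq c c₁ ?_ hc₁.2⟩⟩
    rw [hdist2, hdist2]
    have h1 : G c ≤ G α := hmono (hc.2.trans_lt hc₂.1).le
    have h2 : G c₁ ≤ G c := hmono hc.1
    nlinarith [hc.1, hc.2, hc₂.1]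
  obtain ⟨σp, hσp⟩ := hside Sp hSp_oc fun c hc => ⟨ne_of_gt hc.1, hc.2⟩
  obtain ⟨σm, hσm⟩ := hside Sm hSm_oc fun c hc => ⟨ne_of_lt hc.1, hc.2⟩
  -- the two halves use different arcs
  have hne : σm ≠ σp := by
    intro heq
    -- a point of the other arc in the punctured chart ball
    set τ : Fin 2 := σp + 1 with hτ
    have hconn : IsPreconnected (D.arc τ) :=
      isPreconnected_Icc.image _ D.continuous_boundary.continuousOn
    obtain ⟨z, hzτ, hzR, hzi⟩ : ∃ z ∈ D.arc τ, dist z (D.pt i) < R ∧ z ≠ D.pt i := by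
      by_contra hno
      push Not at hno
      have hsub : D.arc τ ⊆ {D.pt i} ∪ (ball (D.pt i) R)ᶜ := by
        intro z hz
        by_cases h : z = D.pt i
        · exact Or.inl h
        · right
          have := mt (fun h' => (hno z hz h')) h
          simpa [mem_ball, not_lt] using this
      have hdisj : D.arc τ ∩ ({D.pt i} ∩ (ball (D.pt i) R)ᶜ) = ∅ := by
        ext z
        simp only [mem_inter_iff, mem_singleton_iff, mem_compl_iff, mem_ball, not_lt,
          mem_empty_iff_false, iff_false, not_and, not_le]
        rintro - rfl
        simpa using hR
      rcases (isPreconnected_iff_subset_of_disjoint_closed.1 hconn) {D.pt i} (ball (D.pt i) R)ᶜ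
          isClosed_singleton isOpen_ball.isClosed_compl hsub hdisj with h | h
      · have h1 : D.pt (i + 1) ∈ ({D.pt i} : Set ℂ) := h (pt_mem_arc_two D (i + 1) τ)
        rw [mem_singleton_iff] at h1
        exact hfin i (D.pt_injective h1)
      · have h1 : D.pt i ∈ (ball (D.pt i) R)ᶜ := h (pt_mem_arc_two D i τ)
        exact h1 (mem_ball_self hR)
    -- it is a graph point `P c`, `c ≠ α`
    obtain ⟨c, d, rfl⟩ := exists_frame_coord5 hs ht hU hV z
    have hzf : (c : ℂ) * U + (d : ℂ) * V ∈ frontier D.carrier := D.arc_subset_frontier τ hzτ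
    have hd : d = G c := frontier_coord5 hs ht hU hV D.isOpen hLip hchart hzf hzR
    subst hd
    have hcα : c ≠ α := fun h => hzi (by rw [← hPα]; simp only [hP, h])
    -- hence on the arc `σp` as well: a mark — contradiction
    have hzσ : P c ∈ D.arc σp := by
      rcases lt_or_gt_of_ne hcα with h | h
      · rw [← heq]; exact hσm c ⟨h, hzR⟩
      · exact hσp c ⟨h, hzR⟩
    exact honly c hcα hzR σp hzσ hzτ
  have hσm' : σm = σp + 1 := hfin3 σp σm hne
  refine ⟨σp, fun c hc hd => ⟨hσp c ⟨hc, hd⟩, honly c (ne_of_gt hc) hd σp (hσp c ⟨hc, hd⟩)⟩,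
    fun c hc hd => ⟨hσm' ▸ hσm c ⟨hc, hd⟩, ?_⟩⟩
  have h := honly c (ne_of_lt hc) hd σm (hσm c ⟨hc, hd⟩)
  rwa [hσm', hfin2] at h

end DrefuteG7
end Summit.CriticalPhenomena.CardyFormulaZ2.Cruxes.SLESixFamiliesGiveCardy.CollarTouchSandwich

end
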